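import Mathlib
import Literature.Analysis.FluidPDE.AxisymQuotientRayAverage
import Literature.Analysis.FluidPDE.AxisymmetricVorticityTransport
import Literature.Analysis.FluidPDE.TaoEnstrophyLocalisation
import Literature.Analysis.FluidPDE.ClassicalSolutionCalculus
import HarnessLib

/-!
# Crux `EulerZoomLiouville.PowerGaugeEulerLiouville` (stmt-NavierStokesRegularity-19832), line `mirror-moment`, towards stub M1:
# `ω_θ/r` VANISHES ON THE MIRROR PLANE AND IS `O(|x₂|)` ON COMPACTS (outgoing sign)

Route №10 `EulerZoomLiouville` (NavierStokesRegularity), crux E.  Line `mirror-moment` (ideator ns-idea-11 g3;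
`Cruxes/PowerGaugeEulerLiouville/Lines/mirror_moment.lean`), lever M1 `stub_momentMonotone` (owner ns-sfl-p1 g3).  A sub-brick requested by
the M1 owner (cell STATUS 10:22:54Z) for the time side of the axial-moment monotonicity: the smooth Hou–Li quotient
`Ω = angVortQuot v = ω_θ/r` (`Literature.Analysis.FluidPDE.angVortQuot`, `r² Ω = swirl (curl v) = r ω_θ`) of an axisymmetric `C³` field with
the OUTGOING sign `0 ≤ x₂ · swirl(curl v)(x)` everywhere

* vanishes on the mirror plane `{x₂ = 0}` (`angVortQuot_eq_zero_of_apply_two_eq_zero`): off the axis `x₂ r² Ω(x₀,x₁,x₂) ≥ 0` forces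
  `Ω ≥ 0` just above and `Ω ≤ 0` just below the plane, so `Ω = 0` on it by continuity; on the axis by continuity again;
* is `O(|x₂|)` on every ball (`exists_abs_angVortQuot_le_mul`): by the tree's ray-average formula
  `Ω(x) = ∫₀¹ s · (curl curl v)₂(s x₀, s x₁, x₂) ds` (`IsAxisymmetric.angVortQuot_eq_integral`) and the mean value theorem for the `C¹`
  function `(curl curl v)₂` between `(s x₀, s x₁, x₂)` and `(s x₀, s x₁, 0)`, `|Ω(x)| = |Ω(x) − Ω(x₀,x₁,0)| ≤ L |x₂|` with
  `L = sup_{B̄(0,ρ)} ‖D (curl curl v)₂‖` (`abs_angVortQuot_le_mul_of_fderiv_bound` is the version with `L` given);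
* and the same UNIFORMLY IN TIME along a jointly smooth family on a compact time interval (`exists_abs_angVortQuot_le_mul_slab`):
  `L = sup_{[T,T'] × B̄(0,ρ)} ‖D_x curl curl u‖`, finite by joint continuity (`IsSmoothSpaceTimeOn.fderiv_slice`).

WHAT THIS IS NOT: not NS, not the crux, not M1 — pointwise real analysis `--supports` stmt-19832 (a brick for the M1 owner's transport
argument); nothing here bears on NS regularity.  [folklore (Hadamard's lemma / mean value theorem); cite: ChoiJeong2025, §3 (the
anti-parallel sign `ω^θ(r,−z) = −ω^θ(r,z)`, `ω^θ ≤ 0` for `z ≥ 0`, time-reversed here)]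
-/

noncomputable section

-- flat `Theorems/<Route><Decl>…` files of one crux share the namespace of the crux (tree convention)
set_option linter.dupNamespace false

open MeasureTheory Set Filter Topology Metric Function
open scoped NNReal ENNReal

namespace Summit.NavierStokesRegularity.NavierStokesRegularity.Theorems.PowerGaugeEulerLiouville.MirrorMoment

open Literature.Analysis Literature.Analysis.FluidPDE

variable {v : EuclideanSpace ℝ (Fin 3) → EuclideanSpace ℝ (Fin 3)}

/-! ### Vanishing on the mirror plane -/

/-- `Ω = ω_θ/r` is continuous for `v ∈ C³`. [folklore] -/
theorem continuous_angVortQuot (hv : ContDiff ℝ 3 v) : Continuous (angVortQuot v) :=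
  (contDiff_angVortQuot (n := 0) (hv.of_le (by norm_num))).continuous

/-- Off the axis, on the mirror plane, `Ω = 0` (one-sided limits of the outgoing sign). [folklore] -/
theorem angVortQuot_eq_zero_of_apply_two_eq_zero_of_cylRadius_ne_zero (hv : ContDiff ℝ 3 v) (hax : IsAxisymmetric v)
    (hout : ∀ y : EuclideanSpace ℝ (Fin 3), 0 ≤ y 2 * swirl (curl v) y) {x : EuclideanSpace ℝ (Fin 3)} (hx : x 2 = 0)
    (hr : cylRadius x ≠ 0) : angVortQuot v x = 0 := by
  set q := angVortQuot v with hq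
  have hqc : Continuous q := continuous_angVortQuot hv
  -- the vertical line through `x`
  set γ : ℝ → EuclideanSpace ℝ (Fin 3) := fun t => x + t • EuclideanSpace.single 2 (1 : ℝ) with hγ
  have hγc : Continuous γ := continuous_const.add (continuous_id.smul continuous_const)
  have hγ0 : γ 0 = x := by simp [hγ]
  have hγ2 : ∀ t, γ t 2 = t := fun t => by simp [hγ, hx]
  have hγr : ∀ t, cylRadius (γ t) = cylRadius x := fun t => by
    simp [hγ, cylRadius]
  have hr2 : 0 < cylRadius x ^ 2 := by positivity
  -- sign of `q` along the line: `t · r² q(γ t) ≥ 0`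
  have hsign : ∀ t, 0 ≤ t * (cylRadius x ^ 2 * q (γ t)) := fun t => by
    have h := hout (γ t)
    rw [← hax.cylRadius_sq_mul_angVortQuot hv (γ t), hγ2 t, hγr t] at h
    exact h
  have hlim : Tendsto (fun t => q (γ t)) (𝓝 0) (𝓝 (q x)) := by
    rw [← hγ0]; exact (hqc.comp hγc).tendsto 0
  -- from the right: `q ≥ 0`; from the left: `q ≤ 0`
  have hge : 0 ≤ q x := by
    refine ge_of_tendsto (hlim.mono_left (nhdsWithin_le_nhds (s := Ioi (0 : ℝ)))) ?_
    filter_upwards [self_mem_nhdsWithin (s := Ioi (0 : ℝ))] with t ht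
    have h := hsign t
    have ht' : (0 : ℝ) < t := ht
    nlinarith [mul_pos ht' hr2]
  have hle : q x ≤ 0 := by
    refine le_of_tendsto (hlim.mono_left (nhdsWithin_le_nhds (s := Iio (0 : ℝ)))) ?_
    filter_upwards [self_mem_nhdsWithin (s := Iio (0 : ℝ))] with t ht
    have h := hsign t
    have ht' : t < (0 : ℝ) := ht
    nlinarith [mul_pos (neg_pos.2 ht') hr2]
  exact le_antisymm hle hge

/-- **`ω_θ/r` vanishes on the mirror plane** for an axisymmetric `C³` field with the outgoing sign `0 ≤ x₂ · swirl(curl v)`.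
[folklore] -/
theorem angVortQuot_eq_zero_of_apply_two_eq_zero (hv : ContDiff ℝ 3 v) (hax : IsAxisymmetric v)
    (hout : ∀ y : EuclideanSpace ℝ (Fin 3), 0 ≤ y 2 * swirl (curl v) y) {x : EuclideanSpace ℝ (Fin 3)} (hx : x 2 = 0) :
    angVortQuot v x = 0 := by
  by_cases hr : cylRadius x ≠ 0
  · exact angVortQuot_eq_zero_of_apply_two_eq_zero_of_cylRadius_ne_zero hv hax hout hx hr
  -- on the axis (here: `x = 0`): approach along the plane from off-axis points
  push Not at hr
  have hqc : Continuous (angVortQuot v) := continuous_angVortQuot hv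
  set γ : ℝ → EuclideanSpace ℝ (Fin 3) := fun t => x + t • EuclideanSpace.single 0 (1 : ℝ) with hγ
  have hγc : Continuous γ := continuous_const.add (continuous_id.smul continuous_const)
  have hγ0 : γ 0 = x := by simp [hγ]
  obtain ⟨hx0, hx1⟩ := (cylRadius_eq_zero_iff x).1 hr
  have hval : ∀ t, t ≠ 0 → angVortQuot v (γ t) = 0 := fun t ht => by
    refine angVortQuot_eq_zero_of_apply_two_eq_zero_of_cylRadius_ne_zero hv hax hout (x := γ t) ?_ ?_
    · simp [hγ, hx]
    · rw [Ne, cylRadius_eq_zero_iff]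
      simp [hγ, hx0, ht]
  have hlim : Tendsto (fun t => angVortQuot v (γ t)) (𝓝[≠] 0) (𝓝 (angVortQuot v x)) := by
    rw [← hγ0]; exact ((hqc.comp hγc).tendsto 0).mono_left (nhdsWithin_le_nhds (s := {(0 : ℝ)}ᶜ))
  have hzero : Tendsto (fun t => angVortQuot v (γ t)) (𝓝[≠] 0) (𝓝 0) :=
    tendsto_const_nhds.congr' (eventually_nhdsWithin_of_forall fun t ht => (hval t ht).symm)
  exact tendsto_nhds_unique hlim hzero

/-! ### `O(|x₂|)` on compacts -/

/-- `‖x − x₂e₂‖ ≤ ‖x‖` and `(x − x₂e₂)₂ = 0`: the projection onto the mirror plane. [folklore] -/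
theorem norm_sub_apply_two_smul_le (x : EuclideanSpace ℝ (Fin 3)) :
    ‖x - (x 2) • EuclideanSpace.single 2 (1 : ℝ)‖ ≤ ‖x‖ := by
  rw [EuclideanSpace.norm_eq, EuclideanSpace.norm_eq]
  refine Real.sqrt_le_sqrt ?_
  simp [Fin.sum_univ_three, sq_abs]
  nlinarith [sq_nonneg (x 2)]

/-- **`|Ω(x)| ≤ L |x₂|` from a derivative bound** on the ball: if `‖D((curl curl v)₂)(y)‖ ≤ L` for all `y ∈ B̄(0,ρ)`, then
`|angVortQuot v x| ≤ L |x₂|` for all `x ∈ B̄(0,ρ)` (ray-average formula + mean value theorem + vanishing on the plane). [folklore] -/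
theorem abs_angVortQuot_le_mul_of_fderiv_bound (hv : ContDiff ℝ 3 v) (hax : IsAxisymmetric v)
    (hout : ∀ y : EuclideanSpace ℝ (Fin 3), 0 ≤ y 2 * swirl (curl v) y) {ρ L : ℝ}
    (hL : ∀ y ∈ closedBall (0 : EuclideanSpace ℝ (Fin 3)) ρ, ‖fderiv ℝ (fun z => curl (curl v) z 2) y‖ ≤ L)
    {x : EuclideanSpace ℝ (Fin 3)} (hxρ : x ∈ closedBall (0 : EuclideanSpace ℝ (Fin 3)) ρ) :
    |angVortQuot v x| ≤ L * |x 2| := by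
  -- the `C¹` scalar `c = (curl curl v)₂`
  set c : EuclideanSpace ℝ (Fin 3) → ℝ := fun z => curl (curl v) z 2 with hc
  have hcc2 : ContDiff ℝ 1 (curl (curl v)) := contDiff_curl (n := 1) (contDiff_curl (n := 2) (hv.of_le (by norm_num)))
  have hc1 : ContDiff ℝ 1 c := by
    have e : c = (EuclideanSpace.proj (𝕜 := ℝ) (2 : Fin 3)) ∘ curl (curl v) := by ext z; simp [hc]
    rw [e]; exact (EuclideanSpace.proj (𝕜 := ℝ) (2 : Fin 3)).contDiff.comp hcc2
  have hcd : ∀ y ∈ closedBall (0 : EuclideanSpace ℝ (Fin 3)) ρ, DifferentiableAt ℝ c y :=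
    fun y _ => (hc1.differentiable one_ne_zero) y
  -- the plane projection `p = x − x₂ e₂`
  set p : EuclideanSpace ℝ (Fin 3) := x - (x 2) • EuclideanSpace.single 2 (1 : ℝ) with hp
  have hp2 : p 2 = 0 := by simp [hp]
  have hxn : ‖x‖ ≤ ρ := mem_closedBall_zero_iff.1 hxρ
  have hpρ : p ∈ closedBall (0 : EuclideanSpace ℝ (Fin 3)) ρ :=
    mem_closedBall_zero_iff.2 ((norm_sub_apply_two_smul_le x).trans hxn)
  -- both ray averages
  have hqx : angVortQuot v x = ∫ s in (0 : ℝ)..1, s * c (scaleH s x) := hax.angVortQuot_eq_integral hv x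
  have hqp : angVortQuot v p = ∫ s in (0 : ℝ)..1, s * c (scaleH s p) := hax.angVortQuot_eq_integral hv p
  have hqp0 : angVortQuot v p = 0 := angVortQuot_eq_zero_of_apply_two_eq_zero hv hax hout hp2
  -- scaled points stay in the ball and differ by `x₂ e₂`
  have hsc : ∀ s ∈ Icc (0 : ℝ) 1, ∀ y ∈ closedBall (0 : EuclideanSpace ℝ (Fin 3)) ρ,
      scaleH s y ∈ closedBall (0 : EuclideanSpace ℝ (Fin 3)) ρ := fun s hs y hy =>
    mem_closedBall_zero_iff.2 ((norm_scaleH_le hs y).trans (mem_closedBall_zero_iff.1 hy))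
  have hdiff : ∀ s : ℝ, scaleH s x - scaleH s p = (x 2) • EuclideanSpace.single 2 (1 : ℝ) := fun s => by
    ext i
    fin_cases i <;> simp [hp]
  have hnorm2 : ‖(x 2) • (EuclideanSpace.single 2 (1 : ℝ) : EuclideanSpace ℝ (Fin 3))‖ = |x 2| := by
    rw [norm_smul, Real.norm_eq_abs]; simp
  -- mean value theorem on the (convex) closed ball
  have hmvt : ∀ s ∈ Icc (0 : ℝ) 1, |c (scaleH s x) - c (scaleH s p)| ≤ L * |x 2| := fun s hs => by
    have h := (convex_closedBall (0 : EuclideanSpace ℝ (Fin 3)) ρ).norm_image_sub_le_of_norm_fderiv_le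
      hcd hL (hsc s hs p hpρ) (hsc s hs x hxρ)
    rw [Real.norm_eq_abs, hdiff s, hnorm2] at h
    exact h
  have hL0 : 0 ≤ L := (norm_nonneg _).trans (hL x hxρ)
  -- integrate
  have hci : ∀ y : EuclideanSpace ℝ (Fin 3), Continuous fun s : ℝ => s * c (scaleH s y) := fun y =>
    continuous_id.mul (hc1.continuous.comp (continuous_scaleH_left y))
  rw [show angVortQuot v x = angVortQuot v x - angVortQuot v p by rw [hqp0, sub_zero], hqx, hqp,
    ← intervalIntegral.integral_sub ((hci x).intervalIntegrable 0 1) ((hci p).intervalIntegrable 0 1)]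
  have hb := intervalIntegral.norm_integral_le_of_norm_le_const (a := (0 : ℝ)) (b := 1) (C := L * |x 2|)
    (f := fun s => s * c (scaleH s x) - s * c (scaleH s p)) fun s hs => by
      have hs' : s ∈ Icc (0 : ℝ) 1 := by
        rw [uIoc_of_le zero_le_one] at hs
        exact ⟨hs.1.le, hs.2⟩
      rw [← mul_sub, Real.norm_eq_abs, abs_mul, abs_of_nonneg hs'.1]
      calc s * |c (scaleH s x) - c (scaleH s p)| ≤ 1 * (L * |x 2|) :=
            mul_le_mul hs'.2 (hmvt s hs') (abs_nonneg _) zero_le_one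
        _ = L * |x 2| := one_mul _
  simpa using hb

/-- **`ω_θ/r = O(|x₂|)` on compacts** for one axisymmetric `C³` field with the outgoing sign. [folklore] -/
theorem exists_abs_angVortQuot_le_mul (hv : ContDiff ℝ 3 v) (hax : IsAxisymmetric v)
    (hout : ∀ y : EuclideanSpace ℝ (Fin 3), 0 ≤ y 2 * swirl (curl v) y) (ρ : ℝ) :
    ∃ L : ℝ, 0 ≤ L ∧ ∀ x ∈ closedBall (0 : EuclideanSpace ℝ (Fin 3)) ρ, |angVortQuot v x| ≤ L * |x 2| := by
  have hcc2 : ContDiff ℝ 1 (curl (curl v)) := contDiff_curl (n := 1) (contDiff_curl (n := 2) (hv.of_le (by norm_num)))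
  have hc1 : ContDiff ℝ 1 (fun z => curl (curl v) z 2) := by
    have e : (fun z => curl (curl v) z 2) = (EuclideanSpace.proj (𝕜 := ℝ) (2 : Fin 3)) ∘ curl (curl v) := by ext z; simp
    rw [e]; exact (EuclideanSpace.proj (𝕜 := ℝ) (2 : Fin 3)).contDiff.comp hcc2
  obtain ⟨L, hL⟩ := (isCompact_closedBall (0 : EuclideanSpace ℝ (Fin 3)) ρ).exists_bound_of_continuousOn
    ((hc1.continuous_fderiv one_ne_zero).continuousOn)
  refine ⟨max L 0, le_max_right _ _, fun x hx => ?_⟩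
  exact abs_angVortQuot_le_mul_of_fderiv_bound hv hax hout (fun y hy => (hL y hy).trans (le_max_left _ _)) hx

/-! ### Uniformly in time along a jointly smooth family -/

/-- **`ω_θ/r = O(|x₂|)` on compacts, uniformly on a compact time interval**: for a family `u` jointly smooth on `[T, T'] × ℝ³`
(`IsSmoothSpaceTimeOn (Icc T T') u`, `T < T'`) with axisymmetric slices carrying the outgoing sign, there is one `L` with
`|angVortQuot (u σ) x| ≤ L |x₂|` for all `σ ∈ [T, T']`, `x ∈ B̄(0, ρ)`. [folklore] -/
theorem exists_abs_angVortQuot_le_mul_slab {u : ℝ → EuclideanSpace ℝ (Fin 3) → EuclideanSpace ℝ (Fin 3)} {T T' : ℝ} (hTT' : T < T')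
    (hsm : IsSmoothSpaceTimeOn (Icc T T') u) (hax : ∀ σ ∈ Icc T T', IsAxisymmetric (u σ))
    (hout : ∀ σ ∈ Icc T T', ∀ y : EuclideanSpace ℝ (Fin 3), 0 ≤ y 2 * swirl (curl (u σ)) y) (ρ : ℝ) :
    ∃ L : ℝ, 0 ≤ L ∧ ∀ σ ∈ Icc T T', ∀ x ∈ closedBall (0 : EuclideanSpace ℝ (Fin 3)) ρ, |angVortQuot (u σ) x| ≤ L * |x 2| := by
  have hS : UniqueDiffOn ℝ (Icc T T') := uniqueDiffOn_Icc hTT'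
  -- the second vorticity iterate and its spatial derivative are jointly smooth, hence jointly continuous
  have hω : IsSmoothSpaceTimeOn (Icc T T') (vorticity u) := hsm.isSmoothSpaceTimeOn_vorticity hS
  have hωω : IsSmoothSpaceTimeOn (Icc T T') (vorticity (vorticity u)) := hω.isSmoothSpaceTimeOn_vorticity hS
  have hD : IsSmoothSpaceTimeOn (Icc T T') (fun t x => fderiv ℝ (vorticity (vorticity u) t) x) := hωω.fderiv_slice hS
  have hDc : ContinuousOn (uncurry fun t x => fderiv ℝ (vorticity (vorticity u) t) x) (Icc T T' ×ˢ univ) := hD.continuousOn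
  have hK : IsCompact (Icc T T' ×ˢ closedBall (0 : EuclideanSpace ℝ (Fin 3)) ρ) := isCompact_Icc.prod (isCompact_closedBall _ _)
  obtain ⟨L, hL⟩ := hK.exists_bound_of_continuousOn (hDc.mono (prod_mono Subset.rfl (subset_univ _)))
  refine ⟨max L 0, le_max_right _ _, fun σ hσ x hx => ?_⟩
  have hv3 : ContDiff ℝ 3 (u σ) := (hsm.contDiff_slice hσ).of_le (by norm_cast)
  refine abs_angVortQuot_le_mul_of_fderiv_bound hv3 (hax σ hσ) (hout σ hσ) (fun y hy => ?_) hx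
  -- `‖D((curl curl u_σ)₂)(y)‖ ≤ ‖D(curl curl u_σ)(y)‖ ≤ L`
  have hd : DifferentiableAt ℝ (curl (curl (u σ))) y :=
    ((contDiff_curl (n := 1) (contDiff_curl (n := 2) (hv3.of_le (by norm_num)))).differentiable one_ne_zero) y
  have e : (fun z => curl (curl (u σ)) z 2) = (EuclideanSpace.proj (𝕜 := ℝ) (2 : Fin 3)) ∘ curl (curl (u σ)) := by ext z; simp
  rw [e, fderiv_comp y (EuclideanSpace.proj (𝕜 := ℝ) (2 : Fin 3)).differentiableAt hd, ContinuousLinearMap.fderiv]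
  have hb := hL (σ, y) ⟨hσ, hy⟩
  simp only [uncurry_apply_pair, vorticity_apply] at hb
  have hproj : ‖EuclideanSpace.proj (𝕜 := ℝ) (2 : Fin 3)‖ ≤ 1 :=
    ContinuousLinearMap.opNorm_le_bound _ zero_le_one fun w => by
      rw [one_mul]
      exact PiLp.norm_apply_le w 2
  calc ‖(EuclideanSpace.proj (𝕜 := ℝ) (2 : Fin 3)).comp (fderiv ℝ (curl (curl (u σ))) y)‖
      ≤ ‖EuclideanSpace.proj (𝕜 := ℝ) (2 : Fin 3)‖ * ‖fderiv ℝ (curl (curl (u σ))) y‖ := ContinuousLinearMap.opNorm_comp_le _ _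
    _ ≤ 1 * L := mul_le_mul hproj hb (norm_nonneg _) zero_le_one
    _ ≤ max L 0 := by rw [one_mul]; exact le_max_left _ _

end Summit.NavierStokesRegularity.NavierStokesRegularity.Theorems.PowerGaugeEulerLiouville.MirrorMoment

end
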